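import Summits.HubbardSuperconductivity.HubbardSuperconductivity.Theorems.KkBandLift.Negative.FiniteXFloor
import Summits.HubbardSuperconductivity.HubbardSuperconductivity.Theorems.KkFloorLiftToSummit
import Literature.MathematicalPhysics.QuantumLattice.FinDimSpectrumSectorGibbsLimit
import Literature.Barriers.HubbardSuperconductivity.HohenbergMerminWagnerPairing

/-!
# `KkBandLift` (crux stmt-HubbardSuperconductivity-10402, route `KkFloor`) — negative side:
# the band lift is false as soon as the thermal shell exists (N1 + N2 of the negation skeleton)

Refuter file (B2b-4, HONEST FRAMING: the value here is a THEOREM — `¬ KkBandLift` kernel-checked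
modulo ONE explicit finite-volume hypothesis, the thermal-shell witness — not summit progress).

* `lowEnergy_pairOrder_of_band` — the band lift at side `L` fed into the PROVED finite-height
  Kramers–Kronig floor `finiteXFloor` (N1, `Negative/FiniteXFloor.lean`) at height `x = 1`:
  for EVERY unit sector state `φ`,
  `ε L² (Y₂ - Y₁)/(1 + Y₂²) ≤ π ((Re⟨φ,Hφ⟩ - E₀) + L⁻² Re⟨φ, Δ_dᴴΔ_d φ⟩)` — the band lift forces
  `d`-wave pair order on every sector state of energy density `< ε(Y₂ - Y₁)/(2π(1 + Y₂²))`.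
* `kkBandLift_false_of_thermalShell` — hence `¬ KkBandLift` given the THERMAL-SHELL WITNESS
  (`ThermalShellWitness U δ` of `Cruxes/KkBandLift/StrategistNegation.lean`, stated inline, and
  only asked for at `0 < U`, `δ ∈ (0, ½)` and along EVEN sides): for every `c > 0` and all large
  `L` a unit `φ ∈ szSector N_L 0` with `Re⟨φ,Hφ⟩ ≤ E₀ + cL²` and `Re⟨φ, Δ_dᴴΔ_d φ⟩ ≤ cL⁴`
  (Koma–Tasaki 1992 in the canonical sector + Gibbs shell selection, `Negative/GibbsShellSelection.lean`;
  being landed separately). With `c = ε(Y₂ - Y₁)/(4π(1 + Y₂²))` the two displays read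
  `4πcL² ≤ 2πcL²`.
* `kkBandLift_false_of_thermalShellWitness` — the same with the witness in the skeleton's verbatim
  shape (all sides `L ≥ L₁`).

These are the skeleton's `lowEnergy_pairOrder_of_band` / `not_kkBandLift_of` with the stub
`FiniteXFloor` replaced by the landed theorem. No definition is introduced.
Sources: T. Ransford (1995) §2.4 [Ransford1995]; T. Koma, H. Tasaki, PRL 68 (1992) 3248
[KomaTasakiPRL1992].
-/

set_option linter.dupNamespace false

noncomputable section

namespace Summit.HubbardSuperconductivity.HubbardSuperconductivity.Theorems.KkBandLift.Negative

open Matrix MeasureTheory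
open Literature.MathematicalPhysics.QuantumLattice Literature.Probability.LatticeModels
open Summit.HubbardSuperconductivity.TwTipContinuation.Negative (expect_pairIntensity_nonneg)
open Summit.HubbardSuperconductivity.HubbardSuperconductivity.Theses.KkFloor (KkBandLift)
open scoped ComplexOrder

/-- **Low-energy pair order from the band lift.** The band lift at side `L` (eigenvalues of
`(H + iy L⁻² Δ_dᴴΔ_d)|_V` have real part `≥ E₀ + εL²` for `y ∈ [Y₁, Y₂]`) and the finite-height
floor `finiteXFloor` at `x = 1` give, for every unit `φ ∈ V = szSector (2 N2) 0`,
`ε L² (Y₂ - Y₁)/(1 + Y₂²) ≤ π ((Re⟨φ,Hφ⟩ - E₀) + L⁻² Re⟨φ, Δ_dᴴΔ_d φ⟩)`. [folklore] -/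
theorem lowEnergy_pairOrder_of_band
    (L : ℕ) [NeZero L] (U : ℝ) (N2 : ℕ) {ε Y₁ Y₂ : ℝ} (hε : 0 < ε) (hY₁ : 0 < Y₁) (hY₁₂ : Y₁ < Y₂)
    (hband : ∀ y ∈ Set.Icc Y₁ Y₂, ∀ φ : Fock (Orb (FermionTorus 2 L)),
      φ ∈ szSector (Λ := FermionTorus 2 L) (2 * N2) 0 → φ ≠ 0 → ∀ lam : ℂ,
        (hubbardTorus 2 L 1 U + (Complex.I * (y : ℂ)) • ((((1 : ℝ) / (L : ℝ) ^ 2 : ℝ) : ℂ) •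
          ((pairField dWaveFormFactor L)ᴴ * pairField dWaveFormFactor L))) *ᵥ φ = lam • φ →
        (hubbardTorus 2 L 1 U).minEnergyOn (szSector (Λ := FermionTorus 2 L) (2 * N2) 0) +
          ε * (L : ℝ) ^ 2 ≤ lam.re)
    {φ : Fock (Orb (FermionTorus 2 L))} (hφV : φ ∈ szSector (Λ := FermionTorus 2 L) (2 * N2) 0)
    (hφ1 : star φ ⬝ᵥ φ = 1) :
    ε * (L : ℝ) ^ 2 * (Y₂ - Y₁) / (1 + Y₂ ^ 2) ≤
      Real.pi * (((star φ ⬝ᵥ hubbardTorus 2 L 1 U *ᵥ φ).re -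
          (hubbardTorus 2 L 1 U).minEnergyOn (szSector (Λ := FermionTorus 2 L) (2 * N2) 0)) +
        (1 : ℝ) / (L : ℝ) ^ 2 *
          (star φ ⬝ᵥ ((pairField dWaveFormFactor L)ᴴ * pairField dWaveFormFactor L) *ᵥ φ).re) := by
  set H : Matrix (Finset (Orb (FermionTorus 2 L))) (Finset (Orb (FermionTorus 2 L))) ℂ :=
    hubbardTorus 2 L 1 U with hH
  set P : Matrix (Finset (Orb (FermionTorus 2 L))) (Finset (Orb (FermionTorus 2 L))) ℂ :=
    (pairField dWaveFormFactor L)ᴴ * pairField dWaveFormFactor L with hP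
  set B : Matrix (Finset (Orb (FermionTorus 2 L))) (Finset (Orb (FermionTorus 2 L))) ℂ :=
    ((((1 : ℝ) / (L : ℝ) ^ 2 : ℝ) : ℂ)) • P with hB
  set V : Submodule ℂ (Fock (Orb (FermionTorus 2 L))) :=
    szSector (Λ := FermionTorus 2 L) (2 * N2) 0 with hV
  set E : ℝ := H.minEnergyOn V with hE
  have hL : (0 : ℝ) < (L : ℝ) := Nat.cast_pos.2 (Nat.pos_of_ne_zero (NeZero.ne L))
  have hL2 : (0 : ℝ) < (L : ℝ) ^ 2 := by positivity
  -- hypotheses of the floor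
  have hHh : H.IsHermitian := hubbardTorus_isHermitian (hamiltonian_isHermitian_and_commute_holds _) 1 U
  have hPpsd : P.PosSemidef := pairField_conjTranspose_mul_self_posSemidef dWaveFormFactor L
  have hBh : B.IsHermitian :=
    hPpsd.isHermitian.smul (by rw [isSelfAdjoint_iff, Complex.star_def, Complex.conj_ofReal])
  have hPre : ∀ v : Fock (Orb (FermionTorus 2 L)), 0 ≤ (star v ⬝ᵥ P *ᵥ v).re := fun v =>
    expect_pairIntensity_nonneg L v
  have hBre : ∀ v : Fock (Orb (FermionTorus 2 L)),
      (star v ⬝ᵥ B *ᵥ v).re = (1 : ℝ) / (L : ℝ) ^ 2 * (star v ⬝ᵥ P *ᵥ v).re := by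
    intro v
    rw [hB, smul_mulVec, dotProduct_smul, smul_eq_mul, Complex.re_ofReal_mul]
  have hBnonneg : ∀ v : Fock (Orb (FermionTorus 2 L)), 0 ≤ (star v ⬝ᵥ B *ᵥ v).re := by
    intro v
    rw [hBre]
    exact mul_nonneg (by positivity) (hPre v)
  have hHinv : ∀ v ∈ V, H *ᵥ v ∈ V := fun v hv =>
    Summit.HubbardSuperconductivity.HubbardSuperconductivity.Theorems.hubbardTorus_mulVec_mem_szSector
      2 L 1 U N2 hv
  have hBinv : ∀ v ∈ V, B *ᵥ v ∈ V := by
    intro v hv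
    rw [hB, smul_mulVec]
    exact V.smul_mem _
      (Summit.HubbardSuperconductivity.HubbardSuperconductivity.Theorems.BirGroundStateAverageLRO.Softmin.pairPenalty_mulVec_mem_szSector
        L N2 hv)
  have hEle : ∀ v ∈ V, star v ⬝ᵥ v = 1 → E ≤ (star v ⬝ᵥ H *ᵥ v).re := fun v hv hv1 =>
    minEnergyOn_le_rayleigh_of_mem hHh V hv hv1
  have hEig : ∀ y ∈ Set.Icc Y₁ Y₂, ∀ v ∈ V, v ≠ 0 → ∀ lam : ℂ,
      (H + (Complex.I * (y : ℂ)) • B) *ᵥ v = lam • v →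
        E + (fun _ : ℝ => ε * (L : ℝ) ^ 2) y ≤ lam.re :=
    fun y hy v hv hv0 lam hlam => hband y hy v hv hv0 lam hlam
  -- the finite-height floor at `x = 1` (N1, landed)
  have key := finiteXFloor (Finset (Orb (FermionTorus 2 L))) H B V E 1 (Set.Icc Y₁ Y₂)
    (fun _ => ε * (L : ℝ) ^ 2) hHh hBh hBnonneg hHinv hBinv hEle one_pos hEig φ hφV hφ1
  -- lower bound of the left-hand side on the band: `1/(1+y²) ≥ 1/(1+Y₂²)`
  have hY₂ : 0 < Y₂ := hY₁.trans hY₁₂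
  have hconst : ∀ y ∈ Set.Icc Y₁ Y₂,
      ENNReal.ofReal (ε * (L : ℝ) ^ 2 * (1 / (1 + Y₂ ^ 2))) ≤
        ENNReal.ofReal ((fun _ : ℝ => ε * (L : ℝ) ^ 2) y * ((1 : ℝ) / ((1 : ℝ) ^ 2 + y ^ 2))) := by
    intro y hy
    have hy0 : 0 < y := hY₁.trans_le hy.1
    refine ENNReal.ofReal_le_ofReal (mul_le_mul_of_nonneg_left ?_ (by positivity))
    rw [one_pow]
    refine div_le_div_of_nonneg_left zero_le_one (by positivity) ?_
    nlinarith [pow_le_pow_left₀ hy0.le hy.2 2]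
  have hlow : ENNReal.ofReal (ε * (L : ℝ) ^ 2 * (1 / (1 + Y₂ ^ 2)) * (Y₂ - Y₁)) ≤
      ∫⁻ y in Set.Icc Y₁ Y₂,
        ENNReal.ofReal ((fun _ : ℝ => ε * (L : ℝ) ^ 2) y * ((1 : ℝ) / ((1 : ℝ) ^ 2 + y ^ 2))) := by
    calc ENNReal.ofReal (ε * (L : ℝ) ^ 2 * (1 / (1 + Y₂ ^ 2)) * (Y₂ - Y₁))
        = ENNReal.ofReal (ε * (L : ℝ) ^ 2 * (1 / (1 + Y₂ ^ 2))) * volume (Set.Icc Y₁ Y₂) := by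
          rw [Real.volume_Icc, ENNReal.ofReal_mul (by positivity)]
      _ = ∫⁻ _ in Set.Icc Y₁ Y₂, ENNReal.ofReal (ε * (L : ℝ) ^ 2 * (1 / (1 + Y₂ ^ 2))) := by
          rw [setLIntegral_const]
      _ ≤ ∫⁻ y in Set.Icc Y₁ Y₂,
            ENNReal.ofReal ((fun _ : ℝ => ε * (L : ℝ) ^ 2) y * ((1 : ℝ) / ((1 : ℝ) ^ 2 + y ^ 2))) :=
          setLIntegral_mono' measurableSet_Icc fun y hy => hconst y hy
  have hfin := hlow.trans key
  have hrhs : 0 ≤ Real.pi * (((star φ ⬝ᵥ H *ᵥ φ).re - E) + 1 * (star φ ⬝ᵥ B *ᵥ φ).re) := by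
    refine mul_nonneg Real.pi_pos.le (add_nonneg ?_ ?_)
    · linarith [hEle φ hφV hφ1]
    · rw [one_mul]; exact hBnonneg φ
  rw [ENNReal.ofReal_le_ofReal_iff hrhs, hBre, one_mul] at hfin
  have heq : ε * (L : ℝ) ^ 2 * (1 / (1 + Y₂ ^ 2)) * (Y₂ - Y₁) =
      ε * (L : ℝ) ^ 2 * (Y₂ - Y₁) / (1 + Y₂ ^ 2) := by
    field_simp
  rw [heq] at hfin
  exact hfin

/-- **`¬ KkBandLift` from the thermal shell.** If at every `U > 0` and doping `δ ∈ (0, ½)`, for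
every `c > 0` and all large EVEN sides `L`, the sector `szSector (2⌊(1-δ)L²/2⌋) 0` carries a unit
state of energy `≤ E₀ + cL²` WITHOUT `d`-wave pair order (`Re⟨φ, Δ_dᴴΔ_d φ⟩ ≤ cL⁴`) — the
thermal shell of Koma–Tasaki 1992 — then the band lift `KkBandLift` is false: at the band's
`(U, δ)` take `c = ε(Y₂ - Y₁)/(4π(1 + Y₂²))`, an even `L ≥ L₀, L₁` and the witness `φ`;
`lowEnergy_pairOrder_of_band` reads `4πcL² ≤ 2πcL²`. [cite: KomaTasakiPRL1992] -/
theorem kkBandLift_false_of_thermalShell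
    (hW : ∀ U δ : ℝ, 0 < U → δ ∈ Set.Ioo (0 : ℝ) (1 / 2) → ∀ c : ℝ, 0 < c →
      ∃ L₁ : ℕ, ∀ (L : ℕ) [NeZero L], L₁ ≤ L → Even L →
        ∃ φ : Fock (Orb (FermionTorus 2 L)),
          φ ∈ szSector (Λ := FermionTorus 2 L) (2 * ⌊(1 - δ) * (L : ℝ) ^ 2 / 2⌋₊) 0 ∧
          star φ ⬝ᵥ φ = 1 ∧
          (star φ ⬝ᵥ hubbardTorus 2 L 1 U *ᵥ φ).re ≤
            (hubbardTorus 2 L 1 U).minEnergyOn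
              (szSector (Λ := FermionTorus 2 L) (2 * ⌊(1 - δ) * (L : ℝ) ^ 2 / 2⌋₊) 0) +
              c * (L : ℝ) ^ 2 ∧
          (star φ ⬝ᵥ ((pairField dWaveFormFactor L)ᴴ * pairField dWaveFormFactor L) *ᵥ φ).re ≤
            c * (L : ℝ) ^ 4) :
    ¬ KkBandLift := by
  rintro ⟨U, hU, δ, hδ, ε, hε, Y₁, hY₁, Y₂, hY₁₂, L₀, hband⟩
  have hY₂ : 0 < Y₂ := hY₁.trans hY₁₂
  set c : ℝ := ε * (Y₂ - Y₁) / (4 * Real.pi * (1 + Y₂ ^ 2)) with hc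
  have hcpos : 0 < c := by
    rw [hc]
    exact div_pos (mul_pos hε (sub_pos.2 hY₁₂)) (by positivity)
  obtain ⟨L₁, hL₁⟩ := hW U δ hU hδ c hcpos
  -- an even side beyond both thresholds
  set L : ℕ := 2 * (max L₀ L₁ + 1) with hLdef
  haveI : NeZero L := ⟨by rw [hLdef]; omega⟩
  have hL₀L : L₀ ≤ L := by
    rw [hLdef]; have := le_max_left L₀ L₁; omega
  have hL₁L : L₁ ≤ L := by
    rw [hLdef]; have := le_max_right L₀ L₁; omega
  have hEven : Even L := ⟨max L₀ L₁ + 1, by rw [hLdef]; ring⟩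
  have hLpos : (0 : ℝ) < (L : ℝ) := Nat.cast_pos.2 (Nat.pos_of_ne_zero (NeZero.ne L))
  have hL2 : (0 : ℝ) < (L : ℝ) ^ 2 := by positivity
  obtain ⟨φ, hφV, hφ1, hφE, hφP⟩ := hL₁ L hL₁L hEven
  have key := lowEnergy_pairOrder_of_band L U (⌊(1 - δ) * (L : ℝ) ^ 2 / 2⌋₊) hε hY₁ hY₁₂
    (hband L hL₀L hEven) hφV hφ1
  set eH : ℝ := (star φ ⬝ᵥ hubbardTorus 2 L 1 U *ᵥ φ).re -
      (hubbardTorus 2 L 1 U).minEnergyOn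
        (szSector (Λ := FermionTorus 2 L) (2 * ⌊(1 - δ) * (L : ℝ) ^ 2 / 2⌋₊) 0) with heH
  set eP : ℝ := (star φ ⬝ᵥ ((pairField dWaveFormFactor L)ᴴ * pairField dWaveFormFactor L) *ᵥ φ).re
    with heP
  have h1 : eH ≤ c * (L : ℝ) ^ 2 := by rw [heH]; linarith
  have h2 : (1 : ℝ) / (L : ℝ) ^ 2 * eP ≤ c * (L : ℝ) ^ 2 := by
    rw [div_mul_eq_mul_div, one_mul, div_le_iff₀ hL2]
    calc eP ≤ c * (L : ℝ) ^ 4 := hφP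
      _ = c * (L : ℝ) ^ 2 * (L : ℝ) ^ 2 := by ring
  have h3 : Real.pi * (eH + (1 : ℝ) / (L : ℝ) ^ 2 * eP) ≤ Real.pi * (2 * c * (L : ℝ) ^ 2) := by
    refine mul_le_mul_of_nonneg_left ?_ Real.pi_pos.le
    linarith
  have h4 : Real.pi * (2 * c * (L : ℝ) ^ 2) = ε * (L : ℝ) ^ 2 * (Y₂ - Y₁) / (1 + Y₂ ^ 2) / 2 := by
    rw [hc]
    field_simp
    ring
  have h5 : 0 < ε * (L : ℝ) ^ 2 * (Y₂ - Y₁) / (1 + Y₂ ^ 2) :=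
    div_pos (mul_pos (mul_pos hε hL2) (sub_pos.2 hY₁₂)) (by positivity)
  have := key.trans h3
  rw [h4] at this
  linarith

/-- **`¬ KkBandLift` from the thermal-shell witness in the skeleton's verbatim shape**
(`∀ U δ, 0 < U → δ ∈ (0,½) → ThermalShellWitness U δ` of
`Cruxes/KkBandLift/StrategistNegation.lean`, unfolded; all sides `L ≥ L₁`, not only even ones).
[cite: KomaTasakiPRL1992] -/
theorem kkBandLift_false_of_thermalShellWitness
    (hW : ∀ U δ : ℝ, 0 < U → δ ∈ Set.Ioo (0 : ℝ) (1 / 2) → ∀ c : ℝ, 0 < c →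
      ∃ L₁ : ℕ, ∀ (L : ℕ) [NeZero L], L₁ ≤ L →
        ∃ φ : Fock (Orb (FermionTorus 2 L)),
          φ ∈ szSector (Λ := FermionTorus 2 L) (2 * ⌊(1 - δ) * (L : ℝ) ^ 2 / 2⌋₊) 0 ∧
          star φ ⬝ᵥ φ = 1 ∧
          (star φ ⬝ᵥ hubbardTorus 2 L 1 U *ᵥ φ).re ≤
            (hubbardTorus 2 L 1 U).minEnergyOn
              (szSector (Λ := FermionTorus 2 L) (2 * ⌊(1 - δ) * (L : ℝ) ^ 2 / 2⌋₊) 0) +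
              c * (L : ℝ) ^ 2 ∧
          (star φ ⬝ᵥ ((pairField dWaveFormFactor L)ᴴ * pairField dWaveFormFactor L) *ᵥ φ).re ≤
            c * (L : ℝ) ^ 4) :
    ¬ KkBandLift :=
  kkBandLift_false_of_thermalShell fun U δ hU hδ c hc => by
    obtain ⟨L₁, hL₁⟩ := hW U δ hU hδ c hc
    exact ⟨L₁, fun L _ hL _ => hL₁ L hL⟩

end Summit.HubbardSuperconductivity.HubbardSuperconductivity.Theorems.KkBandLift.Negative

end
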